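import Mathlib
import HarnessLib
import Summits.Ventures.LatticeQCDFlow.Exactness.InvolutiveMetropolis

/-!
# Splitting integrators are time-reversible and volume-preserving — the two hypotheses of the HMC skeleton, discharged

HONEST FRAMING: exact (Metropolis-corrected) sampling algorithms for lattice gauge theory;
figures of merit are autocorrelation/cost numbers at stated couplings and volumes; no
continuum-physics claim.

Venture `LatticeQCDFlow` (cell pub-lqcd), topic `Exactness`, FANOUT row 9 (eng-latcore, the
engine `latflow.core`).  NEW WORK of the cell over Mathlib; nothing here is cited as a fact.
Printed counterparts, named only: Duane–Kennedy–Pendleton–Roweth 1987 (HMC), Sexton–Weingarten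
1992 and Omelyan–Mryglod–Folk 2003 (symmetric splitting integrators), Lüscher 2010 §6.

`InvolutiveMetropolis.lean` (`involMH_isReversible`, row 30) proves: a deterministic proposal
`x ↦ Ψ x` that is an INVOLUTION preserving the reference measure `vol`, Metropolis-corrected with
`min {1, e^{H x − H (Ψ x)}}`, is reversible for `e^{−H} vol` — and names HMC as the instance
`Ψ = (momentum flip) ∘ (leapfrog trajectory)`, with the integrator's REVERSIBILITY and VOLUME
PRESERVATION as the two standing hypotheses.  This file discharges them for the integrators the
engine actually runs (`latflow.core.hmc.HMC(..., integrator = 'leapfrog' | 'omf2' | 'omf4')`,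
`cpn_2d.HMCCPN`, `phi4_2d` HMC): every PALINDROMIC product of momentum KICKS
`(q, p) ↦ (q, p + g q)` and position DRIFTS `(q, p) ↦ (d_p q, p)` driven by measure-preserving
bijections with the time-reversal law `d_{−p} = d_p⁻¹`.

## Content

* Algebra in `Equiv.Perm Ω` (§1): `IsFlipReversible R Φ : R * Φ * R = Φ⁻¹` (time reversal under an
  involution `R`, `R * R = 1`); closed under inverses, powers (`.pow` — a trajectory of `n` steps),
  palindromes `A * B * A` (`.palindrome`) and general symmetric words
  `L.prod * X * L.reverse.prod` (`.symmetricWord` — OMF2 / OMF4 / any symmetric splitting);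
  `.involutive`: `R ∘ Φ` is an involution.  With measure preservation, `flipMH_isReversible`:
  the HMC kernel `involMH (R ∘ Φ)` is reversible for `e^{−H} vol`, for EVERY measurable `H`,
  every step size and every trajectory length (accuracy only drives the acceptance).
* Phase space `Q × P` (§2, momenta in an additive commutative group `P`): `flip (q, p) = (q, −p)`,
  `kick g`, `drift d`, `leapfrog d g = drift d * kick g * drift d`; `kick_isFlipReversible` (no
  hypothesis on the force), `drift_isFlipReversible` (`d (−p) = (d p)⁻¹`), `leapfrog[_pow]_isFlipReversible`.
* Liouville measure `μ.prod ν` (§3): `measurePreserving_flip` (`ν` neg-invariant),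
  `measurePreserving_kick` (`ν` translation-invariant, `g` measurable — any force, exact or not),
  `measurePreserving_drift` (each `d p` preserves `μ`, jointly measurable), `measurePreserving_leapfrog`,
  and the assembled statement `leapfrogHMC_isReversible`.
* The two drifts of practice (§4): FLAT `d p = (· + τ p)` for an additive homomorphism `τ : P →+ Q`
  (scalar / CP(N−1) / φ⁴ HMC: `τ = ε • id`) — `addDrift_reversal`, `measurePreserving_addDrift`;
  and LIE-GROUP `d p = (e p * ·)` on a group `G` with left-invariant (Haar) `μ` for any `e : P → G`
  with `e (−p) = (e p)⁻¹` (gauge HMC: `U ← exp(ε P) U`, `exp(−X) = exp(X)⁻¹`) — `mulDrift_reversal`,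
  `measurePreserving_mulDrift`.  So for the link update of `latflow.core.hmc` the hypotheses hold
  with `μ` = product Haar measure and `ν` = Lebesgue measure on the momenta, whatever the force
  routine computes (a wrong force costs acceptance, never exactness — the content of acceptance
  test A4 `⟨e^{−ΔH}⟩ = 1`).

Not here: the momentum heat-bath half of an HMC update (`HeatBath.lean`, `DecoupledRedraw.lean`),
ergodicity, and anything quantitative (acceptance vs. step size is `Scoring/ExpDeltaH.lean`).
-/

namespace Summit.Ventures.LatticeQCDFlow.Exactness

open MeasureTheory ProbabilityTheory

/-! ## §1 Time reversibility under an involution: algebra in `Equiv.Perm Ω` -/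

section Algebra

variable {Ω : Type*}

/-- `Φ` is **time-reversible under the flip `R`**: `R ∘ Φ ∘ R = Φ⁻¹` (as permutations:
`R * Φ * R = Φ⁻¹`).  Intended for an involution `R` (`R * R = 1`, the momentum flip). -/
def IsFlipReversible (R Φ : Equiv.Perm Ω) : Prop := R * Φ * R = Φ⁻¹

namespace IsFlipReversible

variable {R Φ A B X : Equiv.Perm Ω}

/-- For an involution `R`, conjugation `X ↦ R * X * R` is the group automorphism `MulAut.conj R`. -/
theorem conj_eq (hR : R * R = 1) (X : Equiv.Perm Ω) : R * X * R = MulAut.conj R X := by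
  rw [MulAut.conj_apply, inv_eq_of_mul_eq_one_right hR]

/-- Reversible maps are closed under inversion. -/
theorem inv (h : IsFlipReversible R Φ) (hR : R * R = 1) : IsFlipReversible R Φ⁻¹ := by
  rw [IsFlipReversible, conj_eq hR] at h ⊢
  rw [map_inv, h]

/-- Reversible maps are closed under powers: a trajectory of `n` reversible steps is reversible. -/
theorem pow (h : IsFlipReversible R Φ) (hR : R * R = 1) (n : ℕ) : IsFlipReversible R (Φ ^ n) := by
  rw [IsFlipReversible, conj_eq hR] at h ⊢
  rw [map_pow, h, inv_pow]

/-- Reversible maps are closed under PALINDROMIC products `A * B * A` (leapfrog = drift–kick–drift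
or kick–drift–kick; nesting gives OMF2 `D K D' K D` and OMF4). -/
theorem palindrome (hA : IsFlipReversible R A) (hB : IsFlipReversible R B) (hR : R * R = 1) :
    IsFlipReversible R (A * B * A) := by
  rw [IsFlipReversible, conj_eq hR] at hA hB ⊢
  rw [map_mul, map_mul, hA, hB, mul_inv_rev, mul_inv_rev, mul_assoc]

/-- Reversible maps are closed under general SYMMETRIC WORDS `A₁ ⋯ Aₖ · X · Aₖ ⋯ A₁` — every
symmetric splitting scheme (Sexton–Weingarten, Omelyan–Mryglod–Folk) is of this form. -/
theorem symmetricWord (hR : R * R = 1) (hX : IsFlipReversible R X) :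
    ∀ L : List (Equiv.Perm Ω), (∀ A ∈ L, IsFlipReversible R A) →
      IsFlipReversible R (L.prod * X * L.reverse.prod)
  | [], _ => by simpa using hX
  | A :: L, hL => by
      have hA : IsFlipReversible R A := hL A (by simp)
      have ih := symmetricWord hR hX L (fun B hB => hL B (by simp [hB]))
      have hrw : (A :: L).prod * X * (A :: L).reverse.prod = A * (L.prod * X * L.reverse.prod) * A := by
        simp only [List.prod_cons, List.reverse_cons, List.prod_append, List.prod_nil, mul_one, mul_assoc]
      rw [hrw]
      exact palindrome hA ih hR

/-- **The flip composed with a reversible map is an involution**: `(R ∘ Φ) ∘ (R ∘ Φ) = id`. -/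
theorem involutive (h : IsFlipReversible R Φ) : Function.Involutive ⇑(R * Φ) := by
  intro x
  have h2 : (R * Φ) * (R * Φ) = 1 := by
    rw [← mul_assoc, h, inv_mul_cancel]
  have := congrArg (fun e : Equiv.Perm Ω => e x) h2
  simpa using this

end IsFlipReversible

/-- Measure preservation passes to powers of a permutation (trajectories of `n` steps). -/
theorem measurePreserving_perm_pow [MeasurableSpace Ω] {vol : Measure Ω} {Φ : Equiv.Perm Ω}
    (h : MeasurePreserving (⇑Φ) vol vol) (n : ℕ) : MeasurePreserving (⇑(Φ ^ n)) vol vol := by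
  rw [Equiv.Perm.coe_pow]
  exact h.iterate n

/-- **HMC skeleton with its hypotheses in integrator form.**  If `R` is a `vol`-preserving
involution (momentum flip) and `Φ` (the MD trajectory) is `R`-reversible and `vol`-preserving,
then the Metropolis kernel proposing `R (Φ x)` and accepting with `min {1, e^{H x − H (R (Φ x))}}`
is reversible with respect to `e^{−H} vol`, for every measurable `H`. -/
theorem flipMH_isReversible [MeasurableSpace Ω] {vol : Measure Ω} {R Φ : Equiv.Perm Ω} {H : Ω → ℝ}
    (hH : Measurable H) (hrev : IsFlipReversible R Φ) (hR : MeasurePreserving (⇑R) vol vol)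
    (hΦ : MeasurePreserving (⇑Φ) vol vol) :
    Kernel.IsReversible (involMH (⇑(R * Φ)) (hR.measurable.comp hΦ.measurable) H)
      (vol.withDensity fun x => ENNReal.ofReal (Real.exp (-H x))) :=
  involMH_isReversible hH hrev.involutive (hR.comp hΦ)

/-- … hence `e^{−H} vol` is invariant under that kernel. -/
theorem flipMH_invariant [MeasurableSpace Ω] {vol : Measure Ω} {R Φ : Equiv.Perm Ω} {H : Ω → ℝ}
    (hH : Measurable H) (hrev : IsFlipReversible R Φ) (hR : MeasurePreserving (⇑R) vol vol)
    (hΦ : MeasurePreserving (⇑Φ) vol vol) :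
    Kernel.Invariant (involMH (⇑(R * Φ)) (hR.measurable.comp hΦ.measurable) H)
      (vol.withDensity fun x => ENNReal.ofReal (Real.exp (-H x))) :=
  involMH_invariant hH hrev.involutive (hR.comp hΦ)

end Algebra

/-! ## §2 Phase space `Q × P`: flip, kicks, drifts, leapfrog -/

section PhaseSpace

variable {Q P : Type*}

/-- A **drift** (position update) driven by the momentum through bijections `d p : Q ≃ Q`:
`(q, p) ↦ (d p q, p)`.  Flat HMC: `d p = (· + ε p)`; gauge HMC: `d p = (exp (ε p) * ·)`. -/
def drift (d : P → Equiv.Perm Q) : Equiv.Perm (Q × P) where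
  toFun z := (d z.2 z.1, z.2)
  invFun z := ((d z.2)⁻¹ z.1, z.2)
  left_inv z := by simp
  right_inv z := by simp

/-- A drift is measurable when `(p, q) ↦ d p q` is jointly measurable. -/
theorem measurable_drift [MeasurableSpace Q] [MeasurableSpace P] {d : P → Equiv.Perm Q}
    (hdm : Measurable fun z : P × Q => d z.1 z.2) : Measurable (⇑(drift d)) :=
  (hdm.comp measurable_swap).prodMk measurable_snd

variable [AddCommGroup P]

/-- The **momentum flip** `(q, p) ↦ (q, −p)`. -/
def flip : Equiv.Perm (Q × P) := Equiv.prodCongr (Equiv.refl Q) (Equiv.neg P)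

/-- Pointwise formula for the flip. -/
@[simp] theorem flip_apply (z : Q × P) : (flip : Equiv.Perm (Q × P)) z = (z.1, -z.2) := rfl

/-- The flip is an involution. -/
theorem flip_mul_flip : (flip : Equiv.Perm (Q × P)) * flip = 1 := by
  refine Equiv.ext fun z => ?_
  simp [Equiv.Perm.mul_apply]

/-- The flip is measurable. -/
theorem measurable_flip [MeasurableSpace Q] [MeasurableSpace P] [MeasurableNeg P] :
    Measurable (⇑(flip : Equiv.Perm (Q × P))) :=
  measurable_fst.prodMk measurable_snd.neg

/-- A **kick** (momentum update) by the position-dependent increment `g`: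
`(q, p) ↦ (q, p + g q)`; HMC uses `g q = −ε ∇S(q)` — but NOTHING below depends on what `g` is. -/
def kick (g : Q → P) : Equiv.Perm (Q × P) where
  toFun z := (z.1, z.2 + g z.1)
  invFun z := (z.1, z.2 - g z.1)
  left_inv z := by simp
  right_inv z := by simp

/-- A kick is measurable when the force is. -/
theorem measurable_kick [MeasurableSpace Q] [MeasurableSpace P] [MeasurableAdd₂ P] {g : Q → P}
    (hg : Measurable g) : Measurable (⇑(kick g)) :=
  measurable_fst.prodMk (measurable_snd.add (hg.comp measurable_fst))

/-- **Every kick is time-reversible** — whatever the force: `R K R (q, p) = (q, p − g q) = K⁻¹ (q, p)`. -/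
theorem kick_isFlipReversible (g : Q → P) : IsFlipReversible flip (kick g) := by
  refine Equiv.ext fun z => Prod.ext rfl ?_
  change -(-z.2 + g z.1) = z.2 - g z.1
  abel

/-- **A drift is time-reversible** when reversing the momentum inverts the position map. -/
theorem drift_isFlipReversible {d : P → Equiv.Perm Q} (hd : ∀ p, d (-p) = (d p)⁻¹) :
    IsFlipReversible flip (drift d) := by
  refine Equiv.ext fun z => Prod.ext ?_ ?_
  · change d (-z.2) z.1 = (d z.2)⁻¹ z.1
    rw [hd]
  · change -(-z.2) = z.2
    exact neg_neg z.2

/-- One **leapfrog** step in drift–kick–drift form (the half steps live inside `d`; the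
kick–drift–kick form is the palindrome with roles exchanged, `IsFlipReversible.palindrome`). -/
def leapfrog (d : P → Equiv.Perm Q) (g : Q → P) : Equiv.Perm (Q × P) := drift d * kick g * drift d

/-- Leapfrog is time-reversible. -/
theorem leapfrog_isFlipReversible {d : P → Equiv.Perm Q} (hd : ∀ p, d (-p) = (d p)⁻¹) (g : Q → P) :
    IsFlipReversible flip (leapfrog d g) :=
  (drift_isFlipReversible hd).palindrome (kick_isFlipReversible g) flip_mul_flip

/-- A leapfrog TRAJECTORY of `n` steps is time-reversible. -/
theorem leapfrog_pow_isFlipReversible {d : P → Equiv.Perm Q} (hd : ∀ p, d (-p) = (d p)⁻¹) (g : Q → P)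
    (n : ℕ) : IsFlipReversible flip (leapfrog d g ^ n) :=
  (leapfrog_isFlipReversible hd g).pow flip_mul_flip n

/-- The HMC proposal map `flip ∘ leapfrog^n` is measurable (force and drift measurable). -/
theorem measurable_flip_leapfrog_pow [MeasurableSpace Q] [MeasurableSpace P] [MeasurableNeg P]
    [MeasurableAdd₂ P] {d : P → Equiv.Perm Q} {g : Q → P}
    (hdm : Measurable fun z : P × Q => d z.1 z.2) (hg : Measurable g) (n : ℕ) :
    Measurable (⇑((flip : Equiv.Perm (Q × P)) * leapfrog d g ^ n)) := by
  rw [Equiv.Perm.coe_mul, Equiv.Perm.coe_pow]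
  refine measurable_flip.comp (Measurable.iterate ?_ n)
  rw [leapfrog, Equiv.Perm.coe_mul, Equiv.Perm.coe_mul]
  exact ((measurable_drift hdm).comp (measurable_kick hg)).comp (measurable_drift hdm)

end PhaseSpace

/-! ## §3 Liouville measure: flip, kicks and drifts preserve `μ.prod ν` -/

section Liouville

variable {Q P : Type*} [MeasurableSpace Q] [MeasurableSpace P] {μ : Measure Q} {ν : Measure P}

/-- **A drift preserves `μ ⊗ ν`** when each `d p` preserves `μ` (a skew product over `P`, swapped). -/
theorem measurePreserving_drift [SFinite μ] [SFinite ν] {d : P → Equiv.Perm Q}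
    (hdm : Measurable fun z : P × Q => d z.1 z.2) (hdp : ∀ p, MeasurePreserving (⇑(d p)) μ μ) :
    MeasurePreserving (⇑(drift d)) (μ.prod ν) (μ.prod ν) := by
  have hsk : MeasurePreserving (fun z : P × Q => (id z.1, (fun p q => d p q) z.1 z.2)) (ν.prod μ) (ν.prod μ) :=
    (MeasurePreserving.id ν).skew_product hdm (Filter.Eventually.of_forall fun p => (hdp p).map_eq)
  have h : (⇑(drift d)) = Prod.swap ∘ (fun z : P × Q => (id z.1, (fun p q => d p q) z.1 z.2)) ∘ Prod.swap := by
    funext z; rfl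
  rw [h]
  exact Measure.measurePreserving_swap.comp (hsk.comp Measure.measurePreserving_swap)

variable [AddCommGroup P]

/-- The flip preserves `μ ⊗ ν` when `ν` is symmetric under `p ↦ −p` (Lebesgue, any centred Gaussian). -/
theorem measurePreserving_flip [MeasurableNeg P] [ν.IsNegInvariant] [SFinite μ] [SFinite ν] :
    MeasurePreserving (⇑(flip : Equiv.Perm (Q × P))) (μ.prod ν) (μ.prod ν) := by
  have h : (⇑(flip : Equiv.Perm (Q × P))) = Prod.map id Neg.neg := by
    funext z; rfl
  rw [h]
  exact (MeasurePreserving.id μ).prod (Measure.measurePreserving_neg ν)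

/-- **Every kick preserves `μ ⊗ ν`** when `ν` is translation-invariant and the force is measurable. -/
theorem measurePreserving_kick [MeasurableAdd₂ P] [ν.IsAddRightInvariant] [SFinite μ] [SFinite ν]
    {g : Q → P} (hg : Measurable g) :
    MeasurePreserving (⇑(kick g)) (μ.prod ν) (μ.prod ν) := by
  have h : (⇑(kick g)) = fun z : Q × P => (id z.1, (fun q p => p + g q) z.1 z.2) := by
    funext z; rfl
  rw [h]
  exact (MeasurePreserving.id μ).skew_product (measurable_snd.add (hg.comp measurable_fst))
    (Filter.Eventually.of_forall fun q => (measurePreserving_add_right ν (g q)).map_eq)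

/-- Leapfrog preserves `μ ⊗ ν`. -/
theorem measurePreserving_leapfrog [MeasurableAdd₂ P] [ν.IsAddRightInvariant] [SFinite μ] [SFinite ν]
    {d : P → Equiv.Perm Q} {g : Q → P} (hdm : Measurable fun z : P × Q => d z.1 z.2)
    (hdp : ∀ p, MeasurePreserving (⇑(d p)) μ μ) (hg : Measurable g) :
    MeasurePreserving (⇑(leapfrog d g)) (μ.prod ν) (μ.prod ν) := by
  rw [leapfrog, Equiv.Perm.coe_mul, Equiv.Perm.coe_mul]
  exact ((measurePreserving_drift hdm hdp).comp (measurePreserving_kick hg)).comp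
    (measurePreserving_drift hdm hdp)

/-- **HMC with a leapfrog trajectory is exact.**  For momenta in an additive commutative group
with a translation- and reflection-invariant `ν` (Lebesgue), positions with any `μ` preserved by
the drifts, ANY measurable force `g` and ANY measurable `H` (in practice `H (q, p) = S q + K p`):
the kernel proposing `flip (leapfrog^n (q, p))` with the Metropolis test on `H` is reversible for
`e^{−H} (μ ⊗ ν)` — for every step size (inside `d`, `g`) and every trajectory length `n`. -/
theorem leapfrogHMC_isReversible [MeasurableNeg P] [MeasurableAdd₂ P] [ν.IsNegInvariant]
    [ν.IsAddRightInvariant] [SFinite μ] [SFinite ν] {d : P → Equiv.Perm Q} {g : Q → P}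
    {H : Q × P → ℝ} (hH : Measurable H) (hd : ∀ p, d (-p) = (d p)⁻¹)
    (hdm : Measurable fun z : P × Q => d z.1 z.2) (hdp : ∀ p, MeasurePreserving (⇑(d p)) μ μ)
    (hg : Measurable g) (n : ℕ) :
    Kernel.IsReversible
      (involMH (⇑((flip : Equiv.Perm (Q × P)) * leapfrog d g ^ n)) (measurable_flip_leapfrog_pow hdm hg n) H)
      ((μ.prod ν).withDensity fun z => ENNReal.ofReal (Real.exp (-H z))) :=
  flipMH_isReversible hH (leapfrog_pow_isFlipReversible hd g n) measurePreserving_flip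
    (measurePreserving_perm_pow (measurePreserving_leapfrog hdm hdp hg) n)

/-- … and `e^{−H} (μ ⊗ ν)` is invariant under that HMC kernel. -/
theorem leapfrogHMC_invariant [MeasurableNeg P] [MeasurableAdd₂ P] [ν.IsNegInvariant]
    [ν.IsAddRightInvariant] [SFinite μ] [SFinite ν] {d : P → Equiv.Perm Q} {g : Q → P}
    {H : Q × P → ℝ} (hH : Measurable H) (hd : ∀ p, d (-p) = (d p)⁻¹)
    (hdm : Measurable fun z : P × Q => d z.1 z.2) (hdp : ∀ p, MeasurePreserving (⇑(d p)) μ μ)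
    (hg : Measurable g) (n : ℕ) :
    Kernel.Invariant
      (involMH (⇑((flip : Equiv.Perm (Q × P)) * leapfrog d g ^ n)) (measurable_flip_leapfrog_pow hdm hg n) H)
      ((μ.prod ν).withDensity fun z => ENNReal.ofReal (Real.exp (-H z))) :=
  flipMH_invariant hH (leapfrog_pow_isFlipReversible hd g n) measurePreserving_flip
    (measurePreserving_perm_pow (measurePreserving_leapfrog hdm hdp hg) n)

end Liouville

/-! ## §4 The two drifts of practice satisfy the hypotheses -/

section Drifts

variable {Q P : Type*}

/-- LIE-GROUP drift `U ↦ e p * U` (gauge-link HMC: `U ← exp(ε P) U`), for any `e : P → G` with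
`e (−p) = (e p)⁻¹` — the one property of the exponential map the argument uses. -/
def mulDrift {G : Type*} [Group G] (e : P → G) (p : P) : Equiv.Perm G := Equiv.mulLeft (e p)

/-- The group drift is jointly measurable when `e` is. -/
theorem measurable_mulDrift {G : Type*} [Group G] [MeasurableSpace G] [MeasurableSpace P]
    [MeasurableMul₂ G] {e : P → G} (he : Measurable e) : Measurable fun z : P × G => mulDrift e z.1 z.2 :=
  (he.comp measurable_fst).mul measurable_snd

/-- The group drift preserves any left-invariant `μ` (Haar measure on the links). -/
theorem measurePreserving_mulDrift {G : Type*} [Group G] [MeasurableSpace G] [MeasurableMul G]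
    {μ : Measure G} [μ.IsMulLeftInvariant] (e : P → G) (p : P) :
    MeasurePreserving (⇑(mulDrift e p)) μ μ :=
  measurePreserving_mul_left μ (e p)

variable [AddCommGroup P]

/-- The group drift obeys the time-reversal law. -/
theorem mulDrift_reversal {G : Type*} [Group G] {e : P → G} (he : ∀ p, e (-p) = (e p)⁻¹) (p : P) :
    mulDrift e (-p) = (mulDrift e p)⁻¹ := by
  change Equiv.mulLeft (e (-p)) = (Equiv.mulLeft (e p)).symm
  rw [Equiv.mulLeft_symm, he]

/-- FLAT drift `q ↦ q + τ p` (scalar-field / CP(N−1) / φ⁴ HMC with `τ = ε • id`). -/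
def addDrift [AddGroup Q] (τ : P →+ Q) (p : P) : Equiv.Perm Q := Equiv.addRight (τ p)

/-- The flat drift obeys the time-reversal law `d (−p) = (d p)⁻¹`. -/
theorem addDrift_reversal [AddGroup Q] (τ : P →+ Q) (p : P) : addDrift τ (-p) = (addDrift τ p)⁻¹ := by
  change Equiv.addRight (τ (-p)) = (Equiv.addRight (τ p)).symm
  rw [Equiv.addRight_symm, map_neg]

/-- The flat drift is jointly measurable. -/
theorem measurable_addDrift [AddGroup Q] [MeasurableSpace Q] [MeasurableSpace P] [MeasurableAdd₂ Q]
    {τ : P →+ Q} (hτ : Measurable τ) : Measurable fun z : P × Q => addDrift τ z.1 z.2 :=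
  measurable_snd.add (hτ.comp measurable_fst)

/-- The flat drift preserves any translation-invariant `μ` (Lebesgue). -/
theorem measurePreserving_addDrift [AddGroup Q] [MeasurableSpace Q] [MeasurableAdd Q] {μ : Measure Q}
    [μ.IsAddRightInvariant] (τ : P →+ Q) (p : P) : MeasurePreserving (⇑(addDrift τ p)) μ μ :=
  measurePreserving_add_right μ (τ p)

/-- **Flat-space HMC is exact** (scalar / CP(N−1)-embedding / φ⁴ HMC of `latflow.core`): positions
and momenta in additive groups with translation-invariant measures, drift `q ↦ q + τ p`, any
measurable force and Hamiltonian, any number of leapfrog steps. -/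
theorem flatLeapfrogHMC_isReversible [AddGroup Q] [MeasurableSpace Q] [MeasurableAdd₂ Q]
    [MeasurableSpace P] [MeasurableNeg P] [MeasurableAdd₂ P] {μ : Measure Q} {ν : Measure P}
    [μ.IsAddRightInvariant] [ν.IsNegInvariant] [ν.IsAddRightInvariant] [SFinite μ] [SFinite ν]
    {τ : P →+ Q} (hτ : Measurable τ) {g : Q → P} (hg : Measurable g) {H : Q × P → ℝ}
    (hH : Measurable H) (n : ℕ) :
    Kernel.IsReversible
      (involMH (⇑((flip : Equiv.Perm (Q × P)) * leapfrog (addDrift τ) g ^ n))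
        (measurable_flip_leapfrog_pow (measurable_addDrift hτ) hg n) H)
      ((μ.prod ν).withDensity fun z => ENNReal.ofReal (Real.exp (-H z))) :=
  leapfrogHMC_isReversible hH (addDrift_reversal τ) (measurable_addDrift hτ)
    (measurePreserving_addDrift τ) hg n

/-- **Gauge-link HMC is exact** (the assembled instance for `latflow.core.hmc`): links in a
measurable group `G` with left-invariant `μ`, momenta with Lebesgue-like `ν`, drift
`U ↦ e p * U` with `e (−p) = (e p)⁻¹` and `e` measurable, any measurable force and Hamiltonian,
any number of leapfrog steps. -/
theorem gaugeLeapfrogHMC_isReversible {G : Type*} [Group G] [MeasurableSpace G] [MeasurableMul₂ G]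
    [MeasurableSpace P] [MeasurableNeg P] [MeasurableAdd₂ P] {μ : Measure G} {ν : Measure P}
    [μ.IsMulLeftInvariant] [ν.IsNegInvariant] [ν.IsAddRightInvariant] [SFinite μ] [SFinite ν]
    {e : P → G} (he : ∀ p, e (-p) = (e p)⁻¹) (hem : Measurable e) {g : G → P} (hg : Measurable g)
    {H : G × P → ℝ} (hH : Measurable H) (n : ℕ) :
    Kernel.IsReversible
      (involMH (⇑((flip : Equiv.Perm (G × P)) * leapfrog (mulDrift e) g ^ n))
        (measurable_flip_leapfrog_pow (measurable_mulDrift hem) hg n) H)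
      ((μ.prod ν).withDensity fun z => ENNReal.ofReal (Real.exp (-H z))) :=
  leapfrogHMC_isReversible hH (mulDrift_reversal he) (measurable_mulDrift hem)
    (measurePreserving_mulDrift e) hg n

end Drifts

end Summit.Ventures.LatticeQCDFlow.Exactness
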